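import Literature.Topology.FourManifolds.FreeS3ActionsSevenSphere
import Literature.Geometry.Riemannian.GreatSphereFibrationsHahl
import HarnessLib

/-!
# The quaternionic Hopf action: a free `S³`-action on `S⁷` whose orbit map is a great-3-sphere fibration

Topic `Literature/Topology/FourManifolds`. Reproduces, at statement level:

* A. Hatcher, *Algebraic Topology* (CUP 2002), §4.2 Example 4.46 (the quaternionic Hopf bundle
  `S³ → S⁷ → S⁴ = ℍP¹`); N. Steenrod, *The Topology of Fibre Bundles* (1951), §20: the unit
  quaternions act freely on `S⁷ ⊂ ℍ²` by `q • (u, v) = (q u, q v)`; the orbit of `(u, v)` is the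
  unit sphere of the real 4-dimensional subspace `ℍ·(u, v)` — a GREAT 3-sphere — and the Hopf map
  presents the standard `S⁴` as the orbit space.
* Context: fibrations of spheres by great subspheres — H. Gluck, F. Warner, C. T. Yang, Duke Math.
  J. 50 (1983) 1041–1076; H. Hähl, Results Math. 12 (1987) 99–118 (tree:
  `Literature.Geometry.Riemannian.GreatSphereFibrationsHahl`, whose correctly typed hypothesis
  package `IsSmoothGreatSphereFibration` is reused here instead of new vocabulary).

What is here: ONE named fact — the existence of a free smooth `S³`-action on `S⁷` together with an
orbit map onto the standard `S⁴` which is a smooth great-3-sphere fibration. No proofs; users take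
`(h : ExistsHopfActionS7GreatOrbits)`. It strengthens `ExistsHopfActionS7` of
`FreeS3ActionsSevenSphere.lean` by the great-sphere clause.
-/

noncomputable section

open scoped Manifold ContDiff

namespace Literature.Topology.FourManifolds

/-- NAMED FACT (**the quaternionic Hopf action has great-3-sphere orbits and orbit space `S⁴`**;
Hatcher 2002 §4.2 Example 4.46, Steenrod 1951 §20): identifying `ℝ⁸ = ℍ²`, left multiplication by
unit quaternions is a free smooth `S³`-action on `S⁷` whose orbit through `(u, v)` is the unit
sphere of the real 4-plane `ℍ·(u, v)`; the Hopf map `π : S⁷ → S⁴` is an orbit map for it and a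
smooth great-3-sphere fibration in the sense of
`Literature.Geometry.Riemannian.IsSmoothGreatSphereFibration`. Users take
`(h : ExistsHopfActionS7GreatOrbits)`.
[cite: HatcherAT2002, §4.2 Example 4.46 (quaternionic Hopf bundle S³ → S⁷ → S⁴ via quaternionic lines)] -/
def ExistsHopfActionS7GreatOrbits : Prop :=
  ∃ (a : FreeS3ActionS7)
    (π : Metric.sphere (0 : EuclideanSpace ℝ (Fin (7 + 1))) 1 →
      Metric.sphere (0 : EuclideanSpace ℝ (Fin (4 + 1))) 1),
    a.IsOrbitMap (Metric.sphere (0 : EuclideanSpace ℝ (Fin (4 + 1))) 1) π ∧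
      Literature.Geometry.Riemannian.IsSmoothGreatSphereFibration π

end Literature.Topology.FourManifolds
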